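import Summits.QuantumFields.QCD.Theses.QuarksAsStableAction
import Summits.QuantumFields.QCD.Theses.WilsonQuarkChessboard
import Literature.MathematicalPhysics.QuantumLattice.WilsonDiracAP
import Summits.QuantumFields.QCD.Theorems.QuarksAsStableActionWilsonQuarkStabilityEvenOfQuarkChessboard
import Summits.QuantumFields.QCD.Theorems.QuarksAsStableActionCriticalLineDiamagnetismStubQuarkChessboardOfSchwarz
import Summits.QuantumFields.QCD.Theorems.QuarksAsStableActionWilsonQuarkStabilityParityGlue
import Summits.QuantumFields.QCD.Theorems.QuarksAsStableActionCriticalLineDiamagnetismStubBackgroundSchwarz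
import Summits.QuantumFields.QCD.Theorems.QuarksAsStableActionWilsonQuarkStabilityStubReflectionStep
import Summits.QuantumFields.QCD.Theorems.QuarksAsStableActionWilsonQuarkStabilityStubChessboardOfReflection
import Summits.QuantumFields.QCD.Theorems.QuarksAsStableActionWilsonQuarkStabilityStubCyclicHolder
import Summits.QuantumFields.QCD.Theorems.QuarksAsStableActionWilsonQuarkStabilityStubNormDetChainBlock
import Summits.QuantumFields.QCD.Theorems.QuarksAsStableActionWilsonQuarkStabilityStubStaticIterate
import Summits.QuantumFields.QCD.Theorems.QuarksAsStableActionWilsonQuarkStabilityStubOddOfDiamagnetic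

/-!
# Line `Sketch` (idea `free-tangent-landau-chessboard`) for crux `QuarksAsStableAction.WilsonQuarkStability`
(item stmt-QuantumFields-9736, route route-QuantumFields-QuarksAsStableAction) — SKELETON, cycle 3

Lead prover-line-stmt-QuantumFields-9736-c2-0 (continuation of …-9736-0 and …-9736-c1-0), 2026-08-16.
Sorries only in `stub_*`; `WilsonQuarkStability_of` is the composition concluding the crux
`QuarksAsStableAction.WilsonQuarkStability` BY NAME.

## State of the line

* EVEN tori: proved unconditionally (`wilsonQuarkStability_even`, p127884; stubs 1–6 of cycle 1, the FILS
  iteration p112660 and item 10349), imported; parity glue `wilsonQuarkStability_of_even_of_odd` (p114957).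
* ODD tori (the former single stub `stub_oddVolumes`, handed back by the c1 lead as "crux-sized"): RESHAPED in
  cycle 3 into seven registered stubs whose composition is the odd half with `K = c₂ = C = 0`; six of them are
  LANDED (p129554 reflection step, p129511 chessboard-of-reflection, p129613 cyclic Hölder, p129227 |det E_t|,
  p129571 four-axis iteration, p129515 odd-from-diamagnetic) and imported; ONE sorry remains
  (`stub_staticSliceBound`, worker in flight).

## The odd-volume mechanism (cycle 3): transfer-matrix Hölder chessboard with STATIC extremals

Lüscher's transfer-matrix form of the `r = 1` Wilson determinant is in the tree for EVERY `L ≥ 1`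
(`wilson_det_transfer_form`, p120730, crux 9737): `det D_W[V] = (∏_t det E_t) · det(1 − ∏_{t<L} M_t W_t)` with
`M_t` Hermitian positive definite, a function of the spatial links of slice `t` only, and `W_t` the unitary temporal
transporters.  With the tree's Fock functor (`trace_fockLift : Tr Γ(X) = det(1 + X)`, `fockLift_mul`,
`fockLift_posDef'`, p119264) the second factor is a Fock-space trace `Tr ∏_t Γ(M_t) Γ(W̃_t)` of alternating
POSITIVE and UNITARY letters, and the cyclic Hölder / chessboard inequality
`‖Tr ∏_{t<L} T_t u_t‖^L ≤ ∏_t Tr T_t^L` (stub `stub_cyclicHolder`) holds for every `L`: its extremal words are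
period-ONE (static), so — unlike reflection tilings or Schatten bounds with doubled slabs — nothing forces `L`
even.  For odd `L = 2n+1` it is proved by the Fröhlich–Israel–Lieb–Simon maximiser argument for the MIXED
reflection of the odd cycle (split one positive letter `T = T^{1/2} T^{1/2}`, the antipodal split sits at a
unitary letter, `u u* = 1`; both doubles are again words of length `L`): `stub_reflectionStep` (the Cauchy–Schwarz
step, analytic) and `stub_chessboardOfReflection` (the maximiser/doubling combinatorics, abstract).  Since
`|det E_t|` is blind to the temporal links (`stub_normDetChainBlock`), the Wilson determinant obeys the static
slice bound `‖det D_W[V]‖^L ≤ ∏_s ‖det D_W[S⁰_s V]‖` (`stub_staticSliceBound`; `S⁰_s V` = slice `s` made static,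
temporal links the antiperiodic pattern), and four applications along the four axes (hypercubic covariance
`det_wilsonDirac_swap`, p-landed, any `L`) collapse every field onto the all-seams trivial field
(`stub_staticIterate`): `‖det D_AP[U, m]‖ ≤ ‖det D_AP[𝟙, m]‖` for all odd `L`, all `U`, `m > −1`, which is the
odd half of the crux with `ε = 1/2`, `δ = 1`, `K = c₂ = C = 0`, `L₀ = 0` (`stub_oddOfDiamagnetic`).
No new definitions, no anisotropic tori, no Literature facts.
-/

namespace Summit.QuantumFields.QCD.Cruxes.WilsonQuarkStability.FreeTangentLandauChessboard

open Literature.MathematicalPhysics Literature.MathematicalPhysics.QuantumLattice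
  Literature.MathematicalPhysics.QuantumFieldTheory
open Matrix Complex
open scoped ComplexConjugate BigOperators ComplexOrder

noncomputable section

/-! ## The two parity halves of the crux (verbatim, one token inserted) -/

/-- The crux restricted to EVEN tori: verbatim `QuarksAsStableAction.WilsonQuarkStability` with `Even L →`
inserted (conclusion of the landed `stub_evenOfQuarkChessboard`). -/
def WilsonQuarkStabilityEven : Prop :=
  ∃ ε δ K c₂ C : ℝ, 0 < ε ∧ 0 < δ ∧ ∃ L₀ : ℕ, ∀ (L : ℕ) [NeZero L], L₀ ≤ L → Even L → let apDet : Literature.MathematicalPhysics.QuantumFieldTheory.GaugeConfig 4 L (Matrix.specialUnitaryGroup (Fin 3) ℂ) → ℝ → ℂ := fun U m => Literature.MathematicalPhysics.QuantumLattice.fermionDet (Literature.MathematicalPhysics.QuantumLattice.wilsonDirac (Literature.MathematicalPhysics.QuantumLattice.unitaryFundamentalRep (Fin 3) ℂ) (fun e => if e.1 e.2 = -1 then -(⟨(U e).1, Matrix.specialUnitaryGroup_le_unitaryGroup (U e).2⟩ : Matrix.unitaryGroup (Fin 3) ℂ) else ⟨(U e).1, Matrix.specialUnitaryGroup_le_unitaryGroup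 (U e).2⟩) m 1); let dfc : Literature.MathematicalPhysics.QuantumFieldTheory.GaugeConfig 4 L (Matrix.specialUnitaryGroup (Fin 3) ℂ) → Literature.MathematicalPhysics.QuantumFieldTheory.Plaquette 4 L → ℝ := fun U p => 3 - (Literature.MathematicalPhysics.QuantumLattice.fundamentalRep (Fin 3) (Literature.MathematicalPhysics.QuantumFieldTheory.plaquetteHolonomy U p.1 p.2.1.1 p.2.1.2)).trace.re; ∀ m : ℝ, |m| ≤ ε → ∀ U : Literature.MathematicalPhysics.QuantumFieldTheory.GaugeConfig 4 L (Matrix.specialUnitaryGroup (Fin 3) ℂ), ‖apDet U m‖ ≤ Real.exp (K + c₂ * (∑ p ∈ Finset.univ.filter (fun p => dfc U p < δ), dfc U p) + C * ((Finset.univ.filter (fun p => δ ≤ dfc U p)).card : ℝ)) * ‖apDet 1 m‖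

/-- The crux restricted to ODD tori: verbatim `QuarksAsStableAction.WilsonQuarkStability` with `Odd L →`
inserted (the statement of `stub_oddVolumes`). -/
def WilsonQuarkStabilityOdd : Prop :=
  ∃ ε δ K c₂ C : ℝ, 0 < ε ∧ 0 < δ ∧ ∃ L₀ : ℕ, ∀ (L : ℕ) [NeZero L], L₀ ≤ L → Odd L → let apDet : Literature.MathematicalPhysics.QuantumFieldTheory.GaugeConfig 4 L (Matrix.specialUnitaryGroup (Fin 3) ℂ) → ℝ → ℂ := fun U m => Literature.MathematicalPhysics.QuantumLattice.fermionDet (Literature.MathematicalPhysics.QuantumLattice.wilsonDirac (Literature.MathematicalPhysics.QuantumLattice.unitaryFundamentalRep (Fin 3) ℂ) (fun e => if e.1 e.2 = -1 then -(⟨(U e).1, Matrix.specialUnitaryGroup_le_unitaryGroup (U e).2⟩ : Matrix.unitaryGroup (Fin 3) ℂ) else ⟨(U e).1, Matrix.specialUnitaryGroup_le_unitaryGroup (U e).2⟩) m 1); let dfc : Literature.MathematicalPhysics.QuantumFieldTheory.GaugeConfig 4 L (Matrix.specialUnitaryGroup (Fin 3) ℂ) → Literature.MathematicalPhysics.QuantumFieldTheory.Plaquette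 4 L → ℝ := fun U p => 3 - (Literature.MathematicalPhysics.QuantumLattice.fundamentalRep (Fin 3) (Literature.MathematicalPhysics.QuantumFieldTheory.plaquetteHolonomy U p.1 p.2.1.1 p.2.1.2)).trace.re; ∀ m : ℝ, |m| ≤ ε → ∀ U : Literature.MathematicalPhysics.QuantumFieldTheory.GaugeConfig 4 L (Matrix.specialUnitaryGroup (Fin 3) ℂ), ‖apDet U m‖ ≤ Real.exp (K + c₂ * (∑ p ∈ Finset.univ.filter (fun p => dfc U p < δ), dfc U p) + C * ((Finset.univ.filter (fun p => δ ≤ dfc U p)).card : ℝ)) * ‖apDet 1 m‖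

/-! ## The even half — LANDED (p127884, p114957) -/

/-- Former stub `stub_backgroundSchwarz`: the route declaration `WilsonQuarkChessboard.BackgroundSchwarz` BY NAME
(item stmt-QuantumFields-10349, closed), a theorem of the tree. -/
theorem stub_backgroundSchwarz' : Summit.QuantumFields.QCD.Theses.WilsonQuarkChessboard.BackgroundSchwarz :=
  Summit.QuantumFields.QCD.Cruxes.CriticalLineDiamagnetism.ChessboardCellGain.stub_backgroundSchwarz

/-- **The crux on EVEN tori, unconditional** (= `wilsonQuarkStability_even` of p127884). -/
theorem wilsonQuarkStability_even' : WilsonQuarkStabilityEven :=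
  wilsonQuarkStabilityEven_of_backgroundSchwarz stub_backgroundSchwarz'

/-! ## Cycle-3 stubs for the ODD half

### Stub 1 (analytic) — the mixed reflection step on the odd cycle

For positive semidefinite letters `T a` and unitary letters `U b` (with an identity letter `e` and an inversion
`ι` on letters), the trace of the alternating cyclic word `∏_{j<2n+1} T(c j) U(v j)` obeys the Cauchy–Schwarz
bound of the MIXED reflection of the `(2n+1)`-cycle (positive letter `0` split as `T^{1/2}·T^{1/2}`, the
antipodal unitary letter `n` absorbed by `u u* = 1`): `‖Z(c,v)‖² ≤ ‖Z(c⁺,v⁺)‖ · ‖Z(c⁻,v⁻)‖`, where the doubles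
are `c⁺ = (c₀, c₁, …, c_n, c_n, …, c₁)`, `v⁺ = (v₀, …, v_{n−1}, e, ι v_{n−1}, …, ι v₀)` (`= Tr P Pᴴ`) and
`c⁻ = (c₀, c_{2n}, …, c_{n+1}, c_{n+1}, …, c_{2n})`, `v⁻ = (ι v_{2n}, …, ι v_{n+1}, e, v_{n+1}, …, v_{2n})`
(`= Tr Qᴴ Q`), written with `−j` and `−1−j` in `ZMod (2n+1)`. -/

-- `stub_reflectionStep`: LANDED (imported above).

/-! ### Stub 2 (combinatorial, LEAD) — chessboard estimate from the reflection step on the odd cycle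

Abstract Fröhlich–Israel–Lieb–Simon maximiser argument on the `(2n+1)`-cycle: a non-negative functional `F` of
alternating words `(c, v)` that is rotation invariant, satisfies the mixed reflection step of Stub 1, and takes the
value `ν a > 0` on the homogeneous word `(a, a, …; e, e, …)`, is bounded by the geometric mean of its homogeneous
values: `F(c,v)^{2n+1} ≤ ∏_j ν (c j)`.  (Maximiser of `F^{2n+1}/∏ν` over the finite word space; reflecting through
the unitary letter after a homogeneous block doubles the block; `⌈log₂(n+1)⌉ + 1` doublings reach a homogeneous
maximiser, whose value is `1`.) -/

-- `stub_chessboardOfReflection`: LANDED (imported above).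

/-! ### Stub 3 (LEAD, glue) — the cyclic Hölder / chessboard inequality for odd length

`‖Tr ∏_{i<L} T_i u_i‖^L ≤ ∏_i Re Tr T_i^L` for positive definite `T_i`, unitary `u_i`, odd `L`: Stubs 1 and 2
instantiated at `α = ZMod L` (letters `T_i`), `β = Option (ZMod L × Bool)` (letters `1, u_i, u_iᴴ`), plus rotation
invariance of the trace of a cyclic word. -/

-- `stub_cyclicHolder`: LANDED (imported above).

/-! ### Stub 4 — the chain-block determinant is blind to the temporal links

`E = A P⁻ − P⁺ W = (A P⁻ − P⁺)(P⁻ + W P⁺)` with the second factor unitary when `W` is a unitary commuting with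
the complementary orthogonal projections `P±`. -/

-- `stub_normDetChainBlock`: LANDED (imported above).

/-! ### Stub 5 — the static slice bound in the time direction (odd `L`, `m > −1`)

`‖det D_W[V]‖^L ≤ ∏_s ‖det D_W[S⁰_s V]‖`, where `S⁰_s V` keeps the spatial links of slice `x₀ = s` on every
slice and has temporal links `1`, except `−1` on the seam `x₀ = −1` (the antiperiodic pattern).  From
`wilson_det_transfer_form` (p120730) for `V` and for each `S⁰_s V`, the Fock functor (`trace_fockLift`,
`fockLift_mul`, `fockLift_posDef'`, `fockLift_conjTranspose`), Stub 3 (hypothesis `hH`) and Stub 4 (hypothesis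
`hE`). -/

/-- Stub `stub_staticSliceBound` (see the section docstring). -/
theorem stub_staticSliceBound {L : ℕ} [NeZero L] (hL : Odd L)
    (hH : ∀ {k : Type} [Fintype k] [DecidableEq k] (T u : ZMod L → Matrix k k ℂ),
      (∀ i, (T i).PosDef) → (∀ i, u i ∈ Matrix.unitaryGroup k ℂ) →
      ‖((List.range L).map fun i : ℕ => T (i : ZMod L) * u (i : ZMod L)).prod.trace‖ ^ L ≤
        ∏ i : ZMod L, ((T i) ^ L).trace.re)
    (hE : ∀ {k : Type} [Fintype k] [DecidableEq k] (A Pp Pm W : Matrix k k ℂ),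
      Pp + Pm = 1 → Pp * Pm = 0 → Pm * Pp = 0 → Ppᴴ = Pp → Pmᴴ = Pm →
      W ∈ Matrix.unitaryGroup k ℂ → W * Pp = Pp * W → W * Pm = Pm * W →
      ‖(A * Pm - Pp * W).det‖ = ‖(A * Pm - Pp).det‖)
    (V : GaugeConfig 4 L (Matrix.unitaryGroup (Fin 3) ℂ)) (m : ℝ) (hm : -1 < m) :
    ‖(wilsonDirac (unitaryFundamentalRep (Fin 3) ℂ) V m 1).det‖ ^ L ≤
      ∏ s : ZMod L, ‖(wilsonDirac (unitaryFundamentalRep (Fin 3) ℂ)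
        (fun e : Edge 4 L => if e.2 = 0 then (if e.1 0 = -1 then (-1 : Matrix.unitaryGroup (Fin 3) ℂ) else 1)
          else V (Function.update e.1 0 s, e.2)) m 1).det‖ := by
  sorry

/-! ### Stub 6 — four-axis iteration: every field is dominated by the all-seams trivial field

From the time-direction static slice bound for every field (hypothesis `hS`) and the landed hypercubic
covariance `det_wilsonDirac_swap` (…UnquenchedChessboardBoundStubAxisSwap, any `L`): applying the bound along
the axes `0, 1, 2, 3` in turn makes every link static in every direction, i.e. lands on the field with all links
`1` except `−1` on the four seams `x_μ = −1`; taking the `L⁴`-th root. -/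

-- `stub_staticIterate`: LANDED (imported above).

/-! ### Stub 7 — the odd half of the crux from the diamagnetic inequality

With `ε = 1/2`, `δ = 1`, `K = c₂ = C = 0`, `L₀ = 0`: for `|m| ≤ 1/2` one has `−1 < m`, the crux's
`apDet U m` is `det D_W` of the seamed `U(3)` lift of `U` (a field as in hypothesis `hD`), and `apDet 1 m` is
`det D_W` of the all-seams trivial field. -/

-- `stub_oddOfDiamagnetic`: LANDED (imported above).

/-! ## Composition -/

/-- **The diamagnetic inequality on odd tori**: `‖det D_W[V]‖ ≤ ‖det D_W[all-seams trivial field]‖` for every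
`U(3)` field `V` on `(ℤ/L)⁴`, `L` odd, `m > −1` (Stubs 1–6). -/
theorem diamagnetic_odd (L : ℕ) [NeZero L] (hL : Odd L)
    (V : GaugeConfig 4 L (Matrix.unitaryGroup (Fin 3) ℂ)) (m : ℝ) (hm : -1 < m) :
    ‖(wilsonDirac (unitaryFundamentalRep (Fin 3) ℂ) V m 1).det‖ ≤
      ‖(wilsonDirac (unitaryFundamentalRep (Fin 3) ℂ)
        (fun e : Edge 4 L => if e.1 e.2 = -1 then (-1 : Matrix.unitaryGroup (Fin 3) ℂ) else 1) m 1).det‖ :=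
  stub_staticIterate
    (fun W μ hμ => stub_staticSliceBound hL
      (fun T u hT hu => stub_cyclicHolder
        (fun n T hT U hU e he ι hι c v => stub_reflectionStep n T hT U hU e he ι hι c v)
        (fun n F hF ν hν e ι hιe hrot hrefl hhom c v =>
          stub_chessboardOfReflection n F hF ν hν e ι hιe hrot hrefl hhom c v)
        hL T u hT hu)
      (fun A Pp Pm W' hP hPQ hQP hPph hPmh hW hWp hWm =>
        stub_normDetChainBlock A Pp Pm W' hP hPQ hQP hPph hPmh hW hWp hWm)
      W μ hμ)
    V m hm

/-- Former stub `stub_oddVolumes`, now the composition of Stubs 1–7: the crux on ODD tori. -/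
theorem stub_oddVolumes' : WilsonQuarkStabilityOdd :=
  stub_oddOfDiamagnetic fun L _ hL V m hm => diamagnetic_odd L hL V m hm

/-- **The crux from the stubs**: `WilsonQuarkStability` BY NAME — even tori PROVED (p127884), odd tori from the
cycle-3 stubs via `diamagnetic_odd`, glued by `wilsonQuarkStability_of_even_of_odd` (p114957). -/
theorem WilsonQuarkStability_of :
    Summit.QuantumFields.QCD.Theses.QuarksAsStableAction.WilsonQuarkStability :=
  wilsonQuarkStability_of_even_of_odd wilsonQuarkStability_even' stub_oddVolumes'

end

end Summit.QuantumFields.QCD.Cruxes.WilsonQuarkStability.FreeTangentLandauChessboard
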